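import Summits.KontsevichZagierPeriods.KontsevichZagierPeriods.Theorems.SymplecticScissorsPlanarCompiler
import Summits.KontsevichZagierPeriods.KontsevichZagierPeriods.Theorems.SymplecticScissorsRealOnePeriodRelationsStubGreenOnSquare
import Summits.KontsevichZagierPeriods.KontsevichZagierPeriods.Theorems.PlanarK0Injective.Negative.Kit

/-!
# `PlanarK0Injective` (stmt-KontsevichZagierPeriods-9847) — line `kernel-subgroup-homotopy`,
stub `stub_planarGreenSquare` (Stokes on the unit square as a planar set-chain identity)

Green data `(A, B, S₀)` on the closed unit square `Q` (`A, B` `ℚ`-semialgebraic and continuous on `Q`,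
`dS₀ = A dx + B dy` on the open square) give the PLANAR identity
`Σ_{k,e} (−1)^{k+e+1} ([cell of f_{k,e}⁺] − [cell of f_{k,e}⁻]) ∈ planarGroup` for the four edge traces
`f_{0,e}(t) = B(e, t)`, `f_{1,e}(t) = A(t, e)`: it is the image under the compiler's cell map `Θ`
(`PlanarCompilerProof.stub_cellCompiler`: `Θ [∫ρ] = [cell ρ⁺] − [cell ρ⁻]`) of Green on the square in
dimension one (`RealOnePeriodRelations.stub_greenOnSquare`: `[∫A(·,0)] + [∫B(1,·)] − [∫A(·,1)] − [∫B(0,·)] ∈ M₁`),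
pushed into `planarGroup` by the compiler's landed `stub_elementaryMoves` / `stub_greenAssembly`
(closure induction exactly as in `PlanarCompiler_of`), and finished by rep-independence of cells with equal
domains (`of_sub_of_mem_planarGroup_of_domain_eq`). [Kontsevich–Zagier 2001, §1.2; folklore]
-/

noncomputable section

open MeasureTheory Set
open Literature.NumberTheory.Transcendental Literature.ModelTheory.ExponentialFields
open Summit.KontsevichZagierPeriods.SymplecticScissors.PlanarK0InjectiveNegative (planarGroup
  planarGens of_mem_planarGroup_of_volume_eq_zero of_sub_of_mem_planarGroup_of_domain_eq)
open Summit.KontsevichZagierPeriods.SymplecticScissors.RealOnePeriodRelationsNegative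
  (M₁ greenSet unitDom isSemialgebraic_unitDom)
open Summit.KontsevichZagierPeriods.SymplecticScissors.RealOnePeriodRelations
  (gsq_edge_trace gsq_exists_rep gsq_isSemialgebraicMapOn_top stub_greenOnSquare)
open Summit.KontsevichZagierPeriods.SymplecticScissors.RealOnePeriodRelations.GreenOnSquare
  (vec_mem_square)
open Summit.KontsevichZagierPeriods.SymplecticScissors.PlanarCompilerProof (stub_cellCompiler
  stub_elementaryMoves stub_shearedTransport stub_band stub_signedSweep stub_greenAssembly)

namespace Summit.KontsevichZagierPeriods.SymplecticScissors.KernelSubgroupHomotopy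

/-! ## The three remaining edges of the unit square as `ℚ`-polynomial maps on the unit interval -/

/-- The bottom edge `t ↦ (t, 0)` is a `ℚ`-polynomial map on the unit interval.
[Bochnak–Coste–Roy 1998, §2.2; folklore] -/
private theorem pgs_isSemialgebraicMapOn_bottom :
    IsSemialgebraicMapOn ℚ unitDom (fun z : Fin 1 → ℝ => ![z 0, 0]) :=
  -- adapted from `gsq_isSemialgebraicMapOn_top` (Theorems/SymplecticScissorsRealOnePeriodRelationsGreenOnSquareHelpers1.lean)
  (isSemialgebraicMapOn_aeval isSemialgebraic_unitDom
    (![MvPolynomial.X 0, 0] : Fin 2 → MvPolynomial (Fin 1) ℚ)).congr fun z _ => by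
    ext j; fin_cases j <;> simp

/-- The right edge `t ↦ (1, t)` is a `ℚ`-polynomial map on the unit interval.
[Bochnak–Coste–Roy 1998, §2.2; folklore] -/
private theorem pgs_isSemialgebraicMapOn_right :
    IsSemialgebraicMapOn ℚ unitDom (fun z : Fin 1 → ℝ => ![1, z 0]) :=
  (isSemialgebraicMapOn_aeval isSemialgebraic_unitDom
    (![1, MvPolynomial.X 0] : Fin 2 → MvPolynomial (Fin 1) ℚ)).congr fun z _ => by
    ext j; fin_cases j <;> simp

/-- The left edge `t ↦ (0, t)` is a `ℚ`-polynomial map on the unit interval.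
[Bochnak–Coste–Roy 1998, §2.2; folklore] -/
private theorem pgs_isSemialgebraicMapOn_left :
    IsSemialgebraicMapOn ℚ unitDom (fun z : Fin 1 → ℝ => ![0, z 0]) :=
  (isSemialgebraicMapOn_aeval isSemialgebraic_unitDom
    (![0, MvPolynomial.X 0] : Fin 2 → MvPolynomial (Fin 1) ℚ)).congr fun z _ => by
    ext j; fin_cases j <;> simp

/-- The positive `Θ`-cell over the unit interval, read through a representation with domain
`unitDom` and a literal integrand `g`, is the set `{p | p 0 ∈ (0,1), 0 < p 1 < g (p 0)}`. [folklore] -/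
private theorem pgs_cell_domain_eq {r : KZ.IntegralRep 1} {g : (Fin 1 → ℝ) → ℝ}
    (hd : r.domain = unitDom) (hi : r.integrand = g) {s : KZ.IntegralRep 2}
    (hs : s.domain = {p : Fin 2 → ℝ | (fun _ : Fin 1 => p 0) ∈ r.domain ∧ 0 < p 1 ∧
      p 1 < r.integrand (fun _ : Fin 1 => p 0)}) :
    s.domain = {p : Fin 2 → ℝ | p 0 ∈ Set.Ioo (0 : ℝ) 1 ∧ 0 < p 1 ∧ p 1 < g (fun _ : Fin 1 => p 0)} := by
  rw [hs]
  ext p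
  simp only [mem_setOf_eq, hd, hi, unitDom]

/-- The negative `Θ`-cell over the unit interval, read through a representation with domain
`unitDom` and a literal integrand `g`, is the set `{p | p 0 ∈ (0,1), 0 < p 1 < -g (p 0)}`. [folklore] -/
private theorem pgs_negCell_domain_eq {r : KZ.IntegralRep 1} {g : (Fin 1 → ℝ) → ℝ}
    (hd : r.domain = unitDom) (hi : r.integrand = g) {t : KZ.IntegralRep 2}
    (ht : t.domain = {p : Fin 2 → ℝ | (fun _ : Fin 1 => p 0) ∈ r.domain ∧ 0 < p 1 ∧
      p 1 < -r.integrand (fun _ : Fin 1 => p 0)}) :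
    t.domain = {p : Fin 2 → ℝ | p 0 ∈ Set.Ioo (0 : ℝ) 1 ∧ 0 < p 1 ∧ p 1 < -g (fun _ : Fin 1 => p 0)} := by
  rw [ht]
  ext p
  simp only [mem_setOf_eq, hd, hi, unitDom]

/-! ## The stub -/

/-- **Planar Green on the unit square.** For typed Green data `(A, B, S₀)` on the closed unit square
(`A, B` `ℚ`-semialgebraic and continuous, `dS₀ = A dx + B dy` on the open square) and integrand-`1`
planar representations `ρ k e ±` of the open subgraphs of `± f_{k,e}` over `(0,1)`
(`f_{0,e}(t) = B(e,t)`, `f_{1,e}(t) = A(t,e)`), the signed boundary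
`Σ_{k,e} (−1)^{k+e+1} ([ρ k e +] − [ρ k e −])` lies in the planar set-chain group: it is
`Θ ([∫A(·,0)] + [∫B(1,·)] − [∫A(·,1)] − [∫B(0,·)])` for the cell compiler `Θ` (up to identity moves
between cells with equal domains), and `Θ` maps `M₁ ∋` (Green on the square) into the planar group.
[Kontsevich–Zagier 2001, §1.2; folklore] -/
theorem stub_planarGreenSquare :
    ∀ (A B S₀ : (Fin 2 → ℝ) → ℝ),
      IsSemialgebraicFunOn ℚ {p : Fin 2 → ℝ | 0 ≤ p 0 ∧ p 0 ≤ 1 ∧ 0 ≤ p 1 ∧ p 1 ≤ 1} A →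
      IsSemialgebraicFunOn ℚ {p : Fin 2 → ℝ | 0 ≤ p 0 ∧ p 0 ≤ 1 ∧ 0 ≤ p 1 ∧ p 1 ≤ 1} B →
      ContinuousOn A {p : Fin 2 → ℝ | 0 ≤ p 0 ∧ p 0 ≤ 1 ∧ 0 ≤ p 1 ∧ p 1 ≤ 1} →
      ContinuousOn B {p : Fin 2 → ℝ | 0 ≤ p 0 ∧ p 0 ≤ 1 ∧ 0 ≤ p 1 ∧ p 1 ≤ 1} →
      (∀ p : Fin 2 → ℝ, 0 < p 0 → p 0 < 1 → 0 < p 1 → p 1 < 1 →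
        HasFDerivAt S₀ (A p • (ContinuousLinearMap.proj 0 : (Fin 2 → ℝ) →L[ℝ] ℝ) +
          B p • (ContinuousLinearMap.proj 1 : (Fin 2 → ℝ) →L[ℝ] ℝ)) p) →
      ∀ ρ : Fin 2 → Fin 2 → Bool → KZ.IntegralRep 2,
        (∀ k' e' b, ∀ p ∈ (ρ k' e' b).domain, (ρ k' e' b).integrand p = 1) →
        (ρ 0 0 true).domain = {p : Fin 2 → ℝ | p 0 ∈ Set.Ioo (0 : ℝ) 1 ∧ 0 < p 1 ∧ p 1 < B ![0, p 0]} →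
        (ρ 0 0 false).domain = {p : Fin 2 → ℝ | p 0 ∈ Set.Ioo (0 : ℝ) 1 ∧ 0 < p 1 ∧ p 1 < -B ![0, p 0]} →
        (ρ 0 1 true).domain = {p : Fin 2 → ℝ | p 0 ∈ Set.Ioo (0 : ℝ) 1 ∧ 0 < p 1 ∧ p 1 < B ![1, p 0]} →
        (ρ 0 1 false).domain = {p : Fin 2 → ℝ | p 0 ∈ Set.Ioo (0 : ℝ) 1 ∧ 0 < p 1 ∧ p 1 < -B ![1, p 0]} →
        (ρ 1 0 true).domain = {p : Fin 2 → ℝ | p 0 ∈ Set.Ioo (0 : ℝ) 1 ∧ 0 < p 1 ∧ p 1 < A ![p 0, 0]} →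
        (ρ 1 0 false).domain = {p : Fin 2 → ℝ | p 0 ∈ Set.Ioo (0 : ℝ) 1 ∧ 0 < p 1 ∧ p 1 < -A ![p 0, 0]} →
        (ρ 1 1 true).domain = {p : Fin 2 → ℝ | p 0 ∈ Set.Ioo (0 : ℝ) 1 ∧ 0 < p 1 ∧ p 1 < A ![p 0, 1]} →
        (ρ 1 1 false).domain = {p : Fin 2 → ℝ | p 0 ∈ Set.Ioo (0 : ℝ) 1 ∧ 0 < p 1 ∧ p 1 < -A ![p 0, 1]} →
        ∑ k' : Fin 2, ∑ e' : Fin 2, ((-1 : ℤ) ^ (k'.val + e'.val + 1)) •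
          (KZ.of (ρ k' e' true) - KZ.of (ρ k' e' false)) ∈ planarGroup := by
  intro A B S₀ hA hB hAc hBc hS ρ hρ1 h00t h00f h01t h01f h10t h10f h11t h11f
  -- (i) the cell compiler `Θ` and the elementary moves
  obtain ⟨Θ, hΘ⟩ := stub_cellCompiler
  have hmoves := stub_elementaryMoves Θ hΘ
  -- (ii) `Θ` maps `M₁` into the planar set-chain group (closure induction as in `PlanarCompiler_of`)
  have hΘM : ∀ g ∈ M₁, Θ g ∈ planarGroup := by
    intro g hg
    refine AddSubgroup.closure_induction (fun x hx => ?_) ?_ (fun x y _ _ hx hy => ?_)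
      (fun x _ hx => ?_) hg
    · rcases hx with hx | hx
      · exact hmoves x hx
      · obtain ⟨Δ', A', B', S', r₀₁, r₁₂, r₀₂, hΔ, hA', hB', hAc', hBc', hS', h1, h2, h3, h4, h5, h6,
          rfl⟩ := hx
        subst hΔ
        exact stub_greenAssembly Θ hΘ hmoves stub_shearedTransport stub_band stub_signedSweep A' B' S'
          hA' hB' hAc' hBc' hS' r₀₁ r₁₂ r₀₂ h1 h2 h3 h4 h5 h6
    · simp only [map_zero]; exact zero_mem _
    · simp only [map_add]; exact add_mem hx hy
    · simp only [map_neg]; exact neg_mem hx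
  -- (iii) the four edge representations on the unit interval and Green on the square in `M₁`
  have mB : ∀ z : Fin 1 → ℝ, z 0 ∈ Icc (0 : ℝ) 1 →
      (![z 0, 0] : Fin 2 → ℝ) ∈ {p : Fin 2 → ℝ | 0 ≤ p 0 ∧ p 0 ≤ 1 ∧ 0 ≤ p 1 ∧ p 1 ≤ 1} :=
    fun z hz => vec_mem_square hz.1 hz.2 le_rfl zero_le_one
  have mR : ∀ z : Fin 1 → ℝ, z 0 ∈ Icc (0 : ℝ) 1 →
      (![1, z 0] : Fin 2 → ℝ) ∈ {p : Fin 2 → ℝ | 0 ≤ p 0 ∧ p 0 ≤ 1 ∧ 0 ≤ p 1 ∧ p 1 ≤ 1} :=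
    fun z hz => vec_mem_square zero_le_one le_rfl hz.1 hz.2
  have mT : ∀ z : Fin 1 → ℝ, z 0 ∈ Icc (0 : ℝ) 1 →
      (![z 0, 1] : Fin 2 → ℝ) ∈ {p : Fin 2 → ℝ | 0 ≤ p 0 ∧ p 0 ≤ 1 ∧ 0 ≤ p 1 ∧ p 1 ≤ 1} :=
    fun z hz => vec_mem_square hz.1 hz.2 zero_le_one le_rfl
  have mL : ∀ z : Fin 1 → ℝ, z 0 ∈ Icc (0 : ℝ) 1 →
      (![0, z 0] : Fin 2 → ℝ) ∈ {p : Fin 2 → ℝ | 0 ≤ p 0 ∧ p 0 ≤ 1 ∧ 0 ≤ p 1 ∧ p 1 ≤ 1} :=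
    fun z hz => vec_mem_square le_rfl zero_le_one hz.1 hz.2
  have tB := gsq_edge_trace hA hAc pgs_isSemialgebraicMapOn_bottom (by fun_prop) mB
  have tR := gsq_edge_trace hB hBc pgs_isSemialgebraicMapOn_right (by fun_prop) mR
  have tT := gsq_edge_trace hA hAc gsq_isSemialgebraicMapOn_top (by fun_prop) mT
  have tL := gsq_edge_trace hB hBc pgs_isSemialgebraicMapOn_left (by fun_prop) mL
  obtain ⟨rB, hdB, hiB⟩ : ∃ r : KZ.IntegralRep 1, r.domain = unitDom ∧
      r.integrand = fun z => A ![z 0, 0] := gsq_exists_rep tB.1 tB.2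
  obtain ⟨rR, hdR, hiR⟩ : ∃ r : KZ.IntegralRep 1, r.domain = unitDom ∧
      r.integrand = fun z => B ![1, z 0] := gsq_exists_rep tR.1 tR.2
  obtain ⟨rT, hdT, hiT⟩ : ∃ r : KZ.IntegralRep 1, r.domain = unitDom ∧
      r.integrand = fun z => A ![z 0, 1] := gsq_exists_rep tT.1 tT.2
  obtain ⟨rL, hdL, hiL⟩ : ∃ r : KZ.IntegralRep 1, r.domain = unitDom ∧
      r.integrand = fun z => B ![0, z 0] := gsq_exists_rep tL.1 tL.2
  have hG : KZ.of rB + KZ.of rR - KZ.of rT - KZ.of rL ∈ M₁ :=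
    stub_greenOnSquare A B S₀ hA hB hAc hBc hS rB rR rT rL hdB hdR hdT hdL
      (fun z _ => by simp only [hiB]) (fun z _ => by simp only [hiR])
      (fun z _ => by simp only [hiT]) (fun z _ => by simp only [hiL])
  -- (iv) the `Θ`-cells of the four edges and their exchange for the given representations
  obtain ⟨sB, tB', hsB, htB, hsB1, htB1, hΘB⟩ := hΘ.1 rB
  obtain ⟨sR, tR', hsR, htR, hsR1, htR1, hΘR⟩ := hΘ.1 rR
  obtain ⟨sT, tT', hsT, htT, hsT1, htT1, hΘT⟩ := hΘ.1 rT
  obtain ⟨sL, tL', hsL, htL, hsL1, htL1, hΘL⟩ := hΘ.1 rL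
  have dB : KZ.of sB - KZ.of (ρ 1 0 true) ∈ planarGroup :=
    of_sub_of_mem_planarGroup_of_domain_eq _ _ hsB1 (hρ1 1 0 true)
      ((pgs_cell_domain_eq hdB hiB hsB).trans h10t.symm)
  have dB' : KZ.of tB' - KZ.of (ρ 1 0 false) ∈ planarGroup :=
    of_sub_of_mem_planarGroup_of_domain_eq _ _ htB1 (hρ1 1 0 false)
      ((pgs_negCell_domain_eq hdB hiB htB).trans h10f.symm)
  have dR : KZ.of sR - KZ.of (ρ 0 1 true) ∈ planarGroup :=
    of_sub_of_mem_planarGroup_of_domain_eq _ _ hsR1 (hρ1 0 1 true)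
      ((pgs_cell_domain_eq hdR hiR hsR).trans h01t.symm)
  have dR' : KZ.of tR' - KZ.of (ρ 0 1 false) ∈ planarGroup :=
    of_sub_of_mem_planarGroup_of_domain_eq _ _ htR1 (hρ1 0 1 false)
      ((pgs_negCell_domain_eq hdR hiR htR).trans h01f.symm)
  have dT : KZ.of sT - KZ.of (ρ 1 1 true) ∈ planarGroup :=
    of_sub_of_mem_planarGroup_of_domain_eq _ _ hsT1 (hρ1 1 1 true)
      ((pgs_cell_domain_eq hdT hiT hsT).trans h11t.symm)
  have dT' : KZ.of tT' - KZ.of (ρ 1 1 false) ∈ planarGroup :=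
    of_sub_of_mem_planarGroup_of_domain_eq _ _ htT1 (hρ1 1 1 false)
      ((pgs_negCell_domain_eq hdT hiT htT).trans h11f.symm)
  have dL : KZ.of sL - KZ.of (ρ 0 0 true) ∈ planarGroup :=
    of_sub_of_mem_planarGroup_of_domain_eq _ _ hsL1 (hρ1 0 0 true)
      ((pgs_cell_domain_eq hdL hiL hsL).trans h00t.symm)
  have dL' : KZ.of tL' - KZ.of (ρ 0 0 false) ∈ planarGroup :=
    of_sub_of_mem_planarGroup_of_domain_eq _ _ htL1 (hρ1 0 0 false)
      ((pgs_negCell_domain_eq hdL hiL htL).trans h00f.symm)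
  -- (v) bookkeeping
  have hΘg : KZ.of sB - KZ.of tB' + (KZ.of sR - KZ.of tR') - (KZ.of sT - KZ.of tT') -
      (KZ.of sL - KZ.of tL') ∈ planarGroup := by
    have h := hΘM _ hG
    rwa [map_sub, map_sub, map_add, hΘB, hΘR, hΘT, hΘL] at h
  have hfin := planarGroup.sub_mem (planarGroup.add_mem (planarGroup.sub_mem (planarGroup.add_mem
    (planarGroup.add_mem (planarGroup.sub_mem (planarGroup.add_mem (planarGroup.sub_mem hΘg dB) dB')
    dR) dR') dT) dT') dL) dL'
  convert hfin using 1
  simp only [Fin.sum_univ_two, Fin.val_zero, Fin.val_one, add_zero, pow_succ, pow_zero, mul_neg,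
    mul_one, neg_neg, neg_smul, one_smul]
  abel

end Summit.KontsevichZagierPeriods.SymplecticScissors.KernelSubgroupHomotopy

end
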